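import Summits.QuantumFields.YangMills.Theorems.FluctuationComparisonRegPrIntLS2BetaLaplaceKnit
import HarnessLib

/-!
# S2β · LAPLACE stub — letter DECAY, the BOOKKEEPING DOOR: the 4-point of `log` of the one-loop constant splits into the 4-point of the
# amplitude∕orbit factor and `−½ ×` the 4-point of `log det` of the transversal Hessian; datum-free factors cancel

Cell `ym3-torus` (rung R3: continuum `SU(2)` Yang–Mills on `T³` — NOT `d = 4`, NOT infinite volume, NOT a mass gap, NOT Clay); width seat `ym-ust-20520-w4` g15;
helper of the crux `stmt-QuantumFields-20520` (`--supports`, NOT a proof of it).  LAPLACE row of LINE g18-1, decomposition of record (T) = CHART∞ ∘ LIMIT ∘ KNIT ∘ DECAY.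
After KNIT (✓`…S2BetaLaplaceKnit.tendsto_fourPt_fluct_of_laplaceLimits`) and LIMIT (✓`…S2BetaLaplaceLimit.laplaceLimit_corner`), (T)'s clustering clause reads
`|fourPt (log ∘ C) U V W Z| ≤ φ₁ J · e^{−κ d}` with `C x = ℓ x ∕ β_K^{m∕2}` and `ℓ x = c₀ · P x ∕ √(D x)` — `c₀ = (2π)^{m∕2} · ν(Kg) ∕ (ν-window constant)` DATUM-FREE
(one group chart for all corners), `P x` = (window integral of the chart density) × (amplitude at the minimiser), `D x = det Ah_x` (transversal Hessian).  THIS FILE: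
* `fourPt_log_div_const` — dividing by a common positive constant does not change the 4-point of `log` (`β_K^{m∕2}`, `c₀` cancel);
* `log_factorisation` — `log (c₀ · P ∕ √D) = log c₀ + log P − ½ log D` (`c₀, P, D > 0`);
* ★`fourPt_log_factorisation` — `fourPt (log ∘ ℓ) = fourPt (log ∘ P) − ½ · fourPt (log ∘ D)`;
* ★★`abs_fourPt_log_oneLoopConst_le` — `|fourPt (log ∘ P)| ≤ ε₁`, `|fourPt (log ∘ D)| ≤ ε₂` ⟹ `|fourPt (log ∘ C)| ≤ ε₁ + ε₂ ∕ 2` for `C = ℓ ∕ b` (`b > 0`):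
  DECAY = ⟨amplitude∕orbit-factor clustering `ε₁`⟩ + ⟨`log det` clustering `ε₂` — ✓`Literature.Analysis.Matrix.abs_fourPt_log_det_le` (LogDetMixedDifference) given the
  S2β localisation rows⟩.
4-points are spelled `(f U − f V) − (f W − f Z)` (the line's `fourPt`).  HONEST SCOPE: bookkeeping on `ℝ`; the two clustering inputs are hypotheses; nothing of
DECAY-in-S2β ∕ LAPLACE ∕ S2β ∕ the crux 20520 is proved; `YM3TorusSU2` NOT proved; the Yang–Mills mass gap (Clay) NOT proved.  Def-free; default heartbeats.
References: [Balaban1985Variational] CMP 102 (1985) Thm 1 (8)–(10) p. 279; [Breitung1994] LNM 1592 Thm 41 p. 56 (the Laplace constant).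
-/

noncomputable section

namespace Summit.QuantumFields.YangMills.Theorems.FluctuationComparisonRegPrIntLS2BetaDecayDoor

variable {X : Type*}

/-- Dividing by a common positive constant does not change the 4-point of `log`. [cite: Breitung1994, Thm 41 p. 56 (bookkeeping)] -/
theorem fourPt_log_div_const {ℓ : X → ℝ} {b : ℝ} (hb : 0 < b) {U V W Z : X}
    (hU : 0 < ℓ U) (hV : 0 < ℓ V) (hW : 0 < ℓ W) (hZ : 0 < ℓ Z) :
    (Real.log (ℓ U / b) - Real.log (ℓ V / b)) - (Real.log (ℓ W / b) - Real.log (ℓ Z / b)) =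
      (Real.log (ℓ U) - Real.log (ℓ V)) - (Real.log (ℓ W) - Real.log (ℓ Z)) := by
  rw [Real.log_div hU.ne' hb.ne', Real.log_div hV.ne' hb.ne', Real.log_div hW.ne' hb.ne', Real.log_div hZ.ne' hb.ne']
  ring

/-- `log (c₀ · P ∕ √D) = log c₀ + log P − ½ · log D` for `c₀, P, D > 0`. [cite: Breitung1994, Thm 41 p. 56 (bookkeeping)] -/
theorem log_factorisation {c₀ P D : ℝ} (hc : 0 < c₀) (hP : 0 < P) (hD : 0 < D) :
    Real.log (c₀ * P / Real.sqrt D) = Real.log c₀ + Real.log P - (1 / 2) * Real.log D := by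
  rw [Real.log_div (mul_pos hc hP).ne' (Real.sqrt_pos.2 hD).ne', Real.log_mul hc.ne' hP.ne', Real.log_sqrt hD.le]
  ring

/-- ★ **THE 4-POINT OF `log` OF THE ONE-LOOP CONSTANT SPLITS**: if `ℓ x = c₀ · P x ∕ √(D x)` at the four corners with a COMMON `c₀ > 0` and `P x, D x > 0`, then
`fourPt (log ∘ ℓ) = fourPt (log ∘ P) − ½ · fourPt (log ∘ D)` (the datum-free `log c₀` cancels). [cite: Balaban1985Variational, Thm 1 (8)-(10) p. 279]
[cite: Breitung1994, Thm 41 p. 56] -/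
theorem fourPt_log_factorisation {ℓ P D : X → ℝ} {c₀ : ℝ} (hc : 0 < c₀) {U V W Z : X}
    (hℓ : ∀ x, x = U ∨ x = V ∨ x = W ∨ x = Z → ℓ x = c₀ * P x / Real.sqrt (D x))
    (hP : ∀ x, x = U ∨ x = V ∨ x = W ∨ x = Z → 0 < P x) (hD : ∀ x, x = U ∨ x = V ∨ x = W ∨ x = Z → 0 < D x) :
    (Real.log (ℓ U) - Real.log (ℓ V)) - (Real.log (ℓ W) - Real.log (ℓ Z)) =
      ((Real.log (P U) - Real.log (P V)) - (Real.log (P W) - Real.log (P Z)))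
        - (1 / 2) * ((Real.log (D U) - Real.log (D V)) - (Real.log (D W) - Real.log (D Z))) := by
  have eU : ℓ U = _ := hℓ U (Or.inl rfl)
  have eV : ℓ V = _ := hℓ V (Or.inr (Or.inl rfl))
  have eW : ℓ W = _ := hℓ W (Or.inr (Or.inr (Or.inl rfl)))
  have eZ : ℓ Z = _ := hℓ Z (Or.inr (Or.inr (Or.inr rfl)))
  rw [eU, eV, eW, eZ,
    log_factorisation hc (hP U (Or.inl rfl)) (hD U (Or.inl rfl)),
    log_factorisation hc (hP V (Or.inr (Or.inl rfl))) (hD V (Or.inr (Or.inl rfl))),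
    log_factorisation hc (hP W (Or.inr (Or.inr (Or.inl rfl)))) (hD W (Or.inr (Or.inr (Or.inl rfl)))),
    log_factorisation hc (hP Z (Or.inr (Or.inr (Or.inr rfl)))) (hD Z (Or.inr (Or.inr (Or.inr rfl))))]
  ring

/-- ★★ **THE DECAY DOOR**: with `C x = ℓ x ∕ b` (`b > 0`; KNIT's `C`, `b = β_K^{m∕2}`), `ℓ x = c₀ · P x ∕ √(D x)` at the four corners (common `c₀ > 0`, `P, D > 0`),
an amplitude∕orbit-factor clustering bound `|fourPt (log ∘ P)| ≤ ε₁` and a `log det` clustering bound `|fourPt (log ∘ D)| ≤ ε₂` (✓`Literature.Analysis.Matrix.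
abs_fourPt_log_det_le` given the localisation rows), the clustering clause of (T) follows: `|fourPt (log ∘ C)| ≤ ε₁ + ε₂ ∕ 2`.
[cite: Balaban1985Variational, Thm 1 (8)-(10) p. 279] [cite: Breitung1994, Thm 41 p. 56] -/
theorem abs_fourPt_log_oneLoopConst_le {ℓ P D : X → ℝ} {c₀ b ε₁ ε₂ : ℝ} (hc : 0 < c₀) (hb : 0 < b) {U V W Z : X}
    (hℓ : ∀ x, x = U ∨ x = V ∨ x = W ∨ x = Z → ℓ x = c₀ * P x / Real.sqrt (D x))
    (hP : ∀ x, x = U ∨ x = V ∨ x = W ∨ x = Z → 0 < P x) (hD : ∀ x, x = U ∨ x = V ∨ x = W ∨ x = Z → 0 < D x)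
    (h₁ : |(Real.log (P U) - Real.log (P V)) - (Real.log (P W) - Real.log (P Z))| ≤ ε₁)
    (h₂ : |(Real.log (D U) - Real.log (D V)) - (Real.log (D W) - Real.log (D Z))| ≤ ε₂) :
    |(Real.log (ℓ U / b) - Real.log (ℓ V / b)) - (Real.log (ℓ W / b) - Real.log (ℓ Z / b))| ≤ ε₁ + ε₂ / 2 := by
  have hℓpos : ∀ x, x = U ∨ x = V ∨ x = W ∨ x = Z → 0 < ℓ x := fun x hx => by
    rw [hℓ x hx]; exact div_pos (mul_pos hc (hP x hx)) (Real.sqrt_pos.2 (hD x hx))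
  rw [fourPt_log_div_const hb (hℓpos U (Or.inl rfl)) (hℓpos V (Or.inr (Or.inl rfl))) (hℓpos W (Or.inr (Or.inr (Or.inl rfl))))
      (hℓpos Z (Or.inr (Or.inr (Or.inr rfl)))),
    fourPt_log_factorisation hc hℓ hP hD]
  refine (abs_sub _ _).trans ?_
  rw [abs_mul, abs_of_pos (by norm_num : (0 : ℝ) < 1 / 2)]
  linarith

end Summit.QuantumFields.YangMills.Theorems.FluctuationComparisonRegPrIntLS2BetaDecayDoor

end
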